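import Literature.ModelTheory.PseudofiniteFields.DefinableSetsToolkit

/-!
# Stub H5 of line LonelyTranslates (c1): the definability toolkit

Crux `PairwiseCurvedTilingsLC` (route DefinableSTPPDichotomy, stmt-MatrixMultiplication-17883),
negative line LonelyTranslates, continuation c1 ("Prop27Reduction").  The registered stub
`stub_definabilityToolkit` packages four closure properties of the subsets of `K^m` presented as
`{x | φ.Realize (Sum.elim x y)}` (a ring formula `φ` with set variables `Fin m`, parameter
variables `Fin n`, parameters `y ∈ K^n`), all proved in
`Literature/ModelTheory/PseudofiniteFields/DefinableSetsToolkit.lean`: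
intersections (`definableSet_inter`), zero / non-vanishing sets of polynomials with coefficients
in `K` (`definableSet_eval_eq_zero`, `definableSet_eval_ne_zero`), pull-back along a substitution
of coordinates and constants (`definableSet_preimage_subst`), and projection along the last
coordinate (`definableSet_exists_snoc`).  It is consumed by the chart induction (`stub_openPiece`)
of the skeleton.
-/

set_option linter.dupNamespace false  -- `Summit.<S>.<S>.…` is the mandated namespace

namespace Summit.MatrixMultiplication.MatrixMultiplication.Theorems.PairwiseCurvedTilingsLC.Negative

open FirstOrder FirstOrder.Language FirstOrder.Ring
open Literature.ModelTheory.PseudofiniteFields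

/-- STUB (helper H5, definability toolkit): sets of the shape `{x | φ(x, y)}` (a ring formula
with parameters from `K`) are closed under intersection, contain polynomial (in)equations with
coefficients in `K`, and are closed under pull-back along coordinate/constant substitutions and
under projection of the last coordinate (`definableSet_inter`, `definableSet_eval_eq_zero`,
`definableSet_eval_ne_zero`, `definableSet_preimage_subst`, `definableSet_exists_snoc`). -/
theorem stub_definabilityToolkit (K : Type) [Field K] [CompatibleRing K] :
    (∀ (m : ℕ) (X Y : Set (Fin m → K)),
      (∃ (n : ℕ) (φ : Language.ring.Formula (Fin m ⊕ Fin n)) (y : Fin n → K),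
        X = {x | φ.Realize (Sum.elim x y)}) →
      (∃ (n : ℕ) (φ : Language.ring.Formula (Fin m ⊕ Fin n)) (y : Fin n → K),
        Y = {x | φ.Realize (Sum.elim x y)}) →
      ∃ (n : ℕ) (φ : Language.ring.Formula (Fin m ⊕ Fin n)) (y : Fin n → K),
        X ∩ Y = {x | φ.Realize (Sum.elim x y)}) ∧
    (∀ (m : ℕ) (P : MvPolynomial (Fin m) K),
      (∃ (n : ℕ) (φ : Language.ring.Formula (Fin m ⊕ Fin n)) (y : Fin n → K),
        {x | MvPolynomial.eval x P = 0} = {x | φ.Realize (Sum.elim x y)}) ∧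
      (∃ (n : ℕ) (φ : Language.ring.Formula (Fin m ⊕ Fin n)) (y : Fin n → K),
        {x | MvPolynomial.eval x P ≠ 0} = {x | φ.Realize (Sum.elim x y)})) ∧
    (∀ (m m' p : ℕ) (f : Fin m → Fin m' ⊕ Fin p) (c : Fin p → K) (X : Set (Fin m → K)),
      (∃ (n : ℕ) (φ : Language.ring.Formula (Fin m ⊕ Fin n)) (y : Fin n → K),
        X = {x | φ.Realize (Sum.elim x y)}) →
      ∃ (n : ℕ) (φ : Language.ring.Formula (Fin m' ⊕ Fin n)) (y : Fin n → K),
        {x' : Fin m' → K | (fun i => Sum.elim x' c (f i)) ∈ X} = {x | φ.Realize (Sum.elim x y)}) ∧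
    (∀ (m : ℕ) (X : Set (Fin (m + 1) → K)),
      (∃ (n : ℕ) (φ : Language.ring.Formula (Fin (m + 1) ⊕ Fin n)) (y : Fin n → K),
        X = {x | φ.Realize (Sum.elim x y)}) →
      ∃ (n : ℕ) (φ : Language.ring.Formula (Fin m ⊕ Fin n)) (y : Fin n → K),
        {x' : Fin m → K | ∃ t : K, Fin.snoc x' t ∈ X} = {x | φ.Realize (Sum.elim x y)}) :=
  ⟨fun _ _ _ hX hY => definableSet_inter hX hY,
    fun _ P => ⟨definableSet_eval_eq_zero P, definableSet_eval_ne_zero P⟩,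
    fun _ _ _ f c _ hX => definableSet_preimage_subst f c hX,
    fun _ _ hX => definableSet_exists_snoc hX⟩

end Summit.MatrixMultiplication.MatrixMultiplication.Theorems.PairwiseCurvedTilingsLC.Negative
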